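import Summits.QuantumFields.YangMills.Theorems.BalabanUVNodesN21TwoRunDominationOfSupCloseness

/-!
# N21 (NE7c) · THE CONSUMER's JUNCTION END-TO-END AT THE GAPPED READING's OWN LETTERS: `cubeStat`-closeness of the two runs at the scale `ε·δ_K` ⇒ the design-(i) deficit of
# run A's term at the re-lettered threshold `cutGrid(i⋆+1)` is at most its two-sided gapped shell `[cutGrid(i⋆+2), cutGrid(i⋆)]` — pointwise, at the selected depth `i⋆`

Track A of `YM-PLAN.md` (cell `pub-ymgap`), node **N21** (NE7c, NOT PRINTED); WIDTH SEAT `pub-ymgap-dag-n21-w2` (gen 3), file 11.  THEOREMS ONLY: 0 `def`, 0 `sorry`; COUNT-NEUTRAL;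
`--kind proof --supports stmt-QuantumFields-27366 --as helper` (K3⁸).  Imports this seat's file 9 `…TwoRunDominationOfSupCloseness` (→ file 3 `…TwoRunDeviceOfBgCloseness`, file 2
`…GappedTopCutDials`, dag-n21-d U2∕U5).  No Theses import; restates nothing.

WHY.  dag-n21-d's gapped reading `crGap₁₃VAt N K₀ jcut ρ n` reads run A's class weight at history `K` RE-LETTERED to `θ⋆ := cutGrid ε ρ_K (i⋆+1)` and its shell as the two-sided collar
`topGapShellAtLevel (cutGrid (i⋆+2)) (cutGrid (i⋆+1)) (cutGrid i⋆)` (U5 `gapWeightA₁₃ ∕ gapShellA₁₃`, `i⋆ = selGapDepth₁₃ θ hP K₀ g₀ os ρ (n K) K t`).  Files 1–3 and 9 give the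
per-point junction at ABSTRACT letters `(θlo, θ, θhi)` clearing a closeness `Δ`; file 3 §4 gives the collar rows at the selected depth from the dial rows.  THIS FILE is the ONE
composition a consumer applies at the reading's letters: the closeness enters in the producer-friendly form of file 9 (`∀ c, |cubeStat^A_{k+1}(c)(V) − cubeStat^B_{k′+1}(ι c)(V′)| ≤ ε·δ_K`,
dag-n21-d's NAMED (2.17) statistic), the dial rows in the form file 2 ∕ file 6 (ii) produce them.

WHAT IS PROVED ([bookkeeping] BY NAME).
* ★★★ `deficit_le_gapShell_at_selGapDepth_of_cubeStat_close` — at `p := runA₁₃ F K₀ g₀ K`, `g := histA₁₃ θ K₀ g₀ K`, any `k`, any run-B data `(p′, g′, k′, ι, V′)`, any `s, Pl ⊆ cubes32 s, V`: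
  dial rows at `K` (`0 ≤ ρ_K ≤ 1`, `(1−ρ_K)^{n_K+2} ≥ 1/2`, `∀ j ≤ n_K+2, δ_K ≤ (1−ρ_K)^j ρ_K`), `0 ≤ ε`, `0 ≤ δ_K` and the `cubeStat`-closeness at scale `ε·δ_K` ⇒
  `aWeightAt θ⋆ − Π_{c ∉ Pl} χ^A_c(θ⋆)χ^B_{ιc}(θ⋆) · Π_{c ∈ Pl} (1−χ^A_c(θ⋆))(1−χ^B_{ιc}(θ⋆)) ≤ aWeightAt θ⋆ − aGapAt (cutGrid (i⋆+2)) (cutGrid i⋆)`.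
* ★★ `aGapAt_le_core_at_selGapDepth_of_cubeStat_close` — same hypotheses: the gapped weight lies below the common-refinement core.

HONEST FRAMING.  The closeness is a HYPOTHESIS (N16's two-run closeness of the (2.16) variables, NOT PRINTED; inhabited for no family here); `ι`, run B's data and the dial rows are
the consumer's; integration against the dressed slot and the joint two-run law is NOT done here (U5 design (i)'s); nothing about `sect3DataOfRecord` ∕ `ukBox` proved; nothing of
Bałaban's asserted; NE7c NOT PRINTED ∕ NOT proved at print's thresholds; **N21 NOT discharged**; K3⁷∕K3⁸ NOT claimed; counts UNMOVED (typed 28∕28 · discharged 5∕27); never a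
count claim.  One finite four-torus programme at fixed `ε` — NOT ℝ⁴, NOT OS, NOT a mass gap, NOT the Clay problem.  No decl below carries a cite tag.
-/

namespace Summit.QuantumFields.YangMills.Theorems.N21GappedCollarDeficitAtSelectedDepth

open Literature.MathematicalPhysics.QuantumFieldTheory.Balaban1983to89
open Literature.MathematicalPhysics.QuantumFieldTheory.Balaban1983to89.T4Continuum
open Literature.MathematicalPhysics.QuantumFieldTheory.Balaban1983to89.Node00
open B14.Eq216Concrete (ukBox)
open GaugeField (plaqHol)
open GaugeGroup (dist1)
open YMDAG.UVSplit (histA₁₃ runA₁₃)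
open Summit.QuantumFields.YangMills.Theorems.N21ShellSplitOfRecord13CoPH (cubeStat cutGrid aGapAt selGapDepth₁₃)
open Summit.QuantumFields.YangMills.Theorems.N21TwoRunDevice (aWeightAt_sub_core_le_aWeightAt_sub_aGapAt_of_bgClose aGapAt_le_core_of_bgClose collar_rows_at_selGapDepth_A)
open Summit.QuantumFields.YangMills.Theorems.N21TwoRunDominationOfSupCloseness (bgDominations_of_cubeStat_close)

open scoped BigOperators

variable {F : T4Family} {N : ℕ} [NeZero N]

/-- ★★★ **THE DESIGN-(i) DEFICIT AT THE READING's LETTERS IS AT MOST THE GAPPED SHELL**, from `cubeStat`-closeness at the scale `ε·δ_K` and the dial rows at `K` (selected depth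
`i⋆ = selGapDepth₁₃ θ hP K₀ g₀ os ρ (n K) K t`; run A's data `p := runA₁₃ F K₀ g₀ K`, `g := histA₁₃ θ K₀ g₀ K`; run B's data, `ι` and the fields free). [bookkeeping] -/
theorem deficit_le_gapShell_at_selGapDepth_of_cubeStat_close (θ : Stage13HParams F N) (hP : θ.Provisos₁₃CoPH F N) (K₀ : ℕ) (g₀ : ℕ → ℝ) (os : List (ULoop F))
    (ρ : ℕ → ℝ) (n : ℕ → ℕ) (δ : ℕ → ℝ) (K : ℕ) (t : ℝ) (M : ℕ) {k : ℕ} {p' : B12.RunParams} {g' : ℕ → ℝ} {k' : ℕ}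
    (ι : Iχ F θ.ν (runA₁₃ F K₀ g₀ K) (histA₁₃ θ K₀ g₀ K) k → Iχ F θ.ν p' g' k')
    (V : GaugeField (F.P (runA₁₃ F K₀ g₀ K).K) (k + 1) (SU N)) (V' : GaugeField (F.P p'.K) (k' + 1) (SU N))
    (hε : 0 ≤ epsOfRecord θ.ν (histA₁₃ θ K₀ g₀ K) (K₀ + K)) (hδ : 0 ≤ δ K) (hρ0 : 0 ≤ ρ K) (hρ1 : ρ K ≤ 1) (hhalf : (1 : ℝ) / 2 ≤ (1 - ρ K) ^ (n K + 2))
    (hcompat : ∀ j, j ≤ n K + 2 → δ K ≤ (1 - ρ K) ^ j * ρ K)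
    (hclose : ∀ c : Iχ F θ.ν (runA₁₃ F K₀ g₀ K) (histA₁₃ θ K₀ g₀ K) k,
      |cubeStat F N θ.ν (histA₁₃ θ K₀ g₀ K) (Kc := (runA₁₃ F K₀ g₀ K).K) (k := k + 1) c V - cubeStat F N θ.ν g' (Kc := p'.K) (k := k' + 1) (ι c) V'| ≤
        epsOfRecord θ.ν (histA₁₃ θ K₀ g₀ K) (K₀ + K) * δ K)
    (s : SeqOfRecord F θ.ν M (histA₁₃ θ K₀ g₀ K) (runA₁₃ F K₀ g₀ K).K k) {Pl : Finset (Iχ F θ.ν (runA₁₃ F K₀ g₀ K) (histA₁₃ θ K₀ g₀ K) k)}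
    (hPl : Pl ⊆ cubes32 F θ.ν M (runA₁₃ F K₀ g₀ K) (histA₁₃ θ K₀ g₀ K) k s) :
    aWeightAt F N θ.ν M (runA₁₃ F K₀ g₀ K) (histA₁₃ θ K₀ g₀ K) k
          (cutGrid θ.ν (histA₁₃ θ K₀ g₀ K) (K₀ + K) (ρ K) (selGapDepth₁₃ θ hP K₀ g₀ os ρ (n K) K t + 1)) s Pl V -
        (∏ c ∈ cubes32 F θ.ν M (runA₁₃ F K₀ g₀ K) (histA₁₃ θ K₀ g₀ K) k s \ Pl,
            (chiFactorAt F N θ.ν (runA₁₃ F K₀ g₀ K) (histA₁₃ θ K₀ g₀ K) k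
                (cutGrid θ.ν (histA₁₃ θ K₀ g₀ K) (K₀ + K) (ρ K) (selGapDepth₁₃ θ hP K₀ g₀ os ρ (n K) K t + 1)) c V *
              chiFactorAt F N θ.ν p' g' k' (cutGrid θ.ν (histA₁₃ θ K₀ g₀ K) (K₀ + K) (ρ K) (selGapDepth₁₃ θ hP K₀ g₀ os ρ (n K) K t + 1)) (ι c) V')) *
          ∏ c ∈ Pl,
            ((1 - chiFactorAt F N θ.ν (runA₁₃ F K₀ g₀ K) (histA₁₃ θ K₀ g₀ K) k
                (cutGrid θ.ν (histA₁₃ θ K₀ g₀ K) (K₀ + K) (ρ K) (selGapDepth₁₃ θ hP K₀ g₀ os ρ (n K) K t + 1)) c V) *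
              (1 - chiFactorAt F N θ.ν p' g' k' (cutGrid θ.ν (histA₁₃ θ K₀ g₀ K) (K₀ + K) (ρ K) (selGapDepth₁₃ θ hP K₀ g₀ os ρ (n K) K t + 1)) (ι c) V')) ≤
      aWeightAt F N θ.ν M (runA₁₃ F K₀ g₀ K) (histA₁₃ θ K₀ g₀ K) k
          (cutGrid θ.ν (histA₁₃ θ K₀ g₀ K) (K₀ + K) (ρ K) (selGapDepth₁₃ θ hP K₀ g₀ os ρ (n K) K t + 1)) s Pl V -
        aGapAt F N θ.ν M (runA₁₃ F K₀ g₀ K) (histA₁₃ θ K₀ g₀ K) k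
          (cutGrid θ.ν (histA₁₃ θ K₀ g₀ K) (K₀ + K) (ρ K) (selGapDepth₁₃ θ hP K₀ g₀ os ρ (n K) K t + 2))
          (cutGrid θ.ν (histA₁₃ θ K₀ g₀ K) (K₀ + K) (ρ K) (selGapDepth₁₃ θ hP K₀ g₀ os ρ (n K) K t)) s Pl V := by
  obtain ⟨hAB, hBA⟩ := bgDominations_of_cubeStat_close F N θ.ν ι V V' hclose
  obtain ⟨hlo, hhi, -, -⟩ := collar_rows_at_selGapDepth_A θ hP K₀ g₀ os ρ n K t hε hρ0 hρ1 hhalf hcompat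
  exact aWeightAt_sub_core_le_aWeightAt_sub_aGapAt_of_bgClose F N θ.ν M ι V V' (mul_nonneg hε hδ) hAB hBA hlo hhi s hPl

/-- ★★ **… AND THE GAPPED WEIGHT LIES BELOW THE COMMON-REFINEMENT CORE** at the reading's letters (same hypotheses). [bookkeeping] -/
theorem aGapAt_le_core_at_selGapDepth_of_cubeStat_close (θ : Stage13HParams F N) (hP : θ.Provisos₁₃CoPH F N) (K₀ : ℕ) (g₀ : ℕ → ℝ) (os : List (ULoop F))
    (ρ : ℕ → ℝ) (n : ℕ → ℕ) (δ : ℕ → ℝ) (K : ℕ) (t : ℝ) (M : ℕ) {k : ℕ} {p' : B12.RunParams} {g' : ℕ → ℝ} {k' : ℕ}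
    (ι : Iχ F θ.ν (runA₁₃ F K₀ g₀ K) (histA₁₃ θ K₀ g₀ K) k → Iχ F θ.ν p' g' k')
    (V : GaugeField (F.P (runA₁₃ F K₀ g₀ K).K) (k + 1) (SU N)) (V' : GaugeField (F.P p'.K) (k' + 1) (SU N))
    (hε : 0 ≤ epsOfRecord θ.ν (histA₁₃ θ K₀ g₀ K) (K₀ + K)) (hδ : 0 ≤ δ K) (hρ0 : 0 ≤ ρ K) (hρ1 : ρ K ≤ 1) (hhalf : (1 : ℝ) / 2 ≤ (1 - ρ K) ^ (n K + 2))
    (hcompat : ∀ j, j ≤ n K + 2 → δ K ≤ (1 - ρ K) ^ j * ρ K)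
    (hclose : ∀ c : Iχ F θ.ν (runA₁₃ F K₀ g₀ K) (histA₁₃ θ K₀ g₀ K) k,
      |cubeStat F N θ.ν (histA₁₃ θ K₀ g₀ K) (Kc := (runA₁₃ F K₀ g₀ K).K) (k := k + 1) c V - cubeStat F N θ.ν g' (Kc := p'.K) (k := k' + 1) (ι c) V'| ≤
        epsOfRecord θ.ν (histA₁₃ θ K₀ g₀ K) (K₀ + K) * δ K)
    (s : SeqOfRecord F θ.ν M (histA₁₃ θ K₀ g₀ K) (runA₁₃ F K₀ g₀ K).K k) {Pl : Finset (Iχ F θ.ν (runA₁₃ F K₀ g₀ K) (histA₁₃ θ K₀ g₀ K) k)}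
    (hPl : Pl ⊆ cubes32 F θ.ν M (runA₁₃ F K₀ g₀ K) (histA₁₃ θ K₀ g₀ K) k s) :
    aGapAt F N θ.ν M (runA₁₃ F K₀ g₀ K) (histA₁₃ θ K₀ g₀ K) k
          (cutGrid θ.ν (histA₁₃ θ K₀ g₀ K) (K₀ + K) (ρ K) (selGapDepth₁₃ θ hP K₀ g₀ os ρ (n K) K t + 2))
          (cutGrid θ.ν (histA₁₃ θ K₀ g₀ K) (K₀ + K) (ρ K) (selGapDepth₁₃ θ hP K₀ g₀ os ρ (n K) K t)) s Pl V ≤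
      (∏ c ∈ cubes32 F θ.ν M (runA₁₃ F K₀ g₀ K) (histA₁₃ θ K₀ g₀ K) k s \ Pl,
          (chiFactorAt F N θ.ν (runA₁₃ F K₀ g₀ K) (histA₁₃ θ K₀ g₀ K) k
              (cutGrid θ.ν (histA₁₃ θ K₀ g₀ K) (K₀ + K) (ρ K) (selGapDepth₁₃ θ hP K₀ g₀ os ρ (n K) K t + 1)) c V *
            chiFactorAt F N θ.ν p' g' k' (cutGrid θ.ν (histA₁₃ θ K₀ g₀ K) (K₀ + K) (ρ K) (selGapDepth₁₃ θ hP K₀ g₀ os ρ (n K) K t + 1)) (ι c) V')) *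
        ∏ c ∈ Pl,
          ((1 - chiFactorAt F N θ.ν (runA₁₃ F K₀ g₀ K) (histA₁₃ θ K₀ g₀ K) k
              (cutGrid θ.ν (histA₁₃ θ K₀ g₀ K) (K₀ + K) (ρ K) (selGapDepth₁₃ θ hP K₀ g₀ os ρ (n K) K t + 1)) c V) *
            (1 - chiFactorAt F N θ.ν p' g' k' (cutGrid θ.ν (histA₁₃ θ K₀ g₀ K) (K₀ + K) (ρ K) (selGapDepth₁₃ θ hP K₀ g₀ os ρ (n K) K t + 1)) (ι c) V')) := by
  obtain ⟨hAB, hBA⟩ := bgDominations_of_cubeStat_close F N θ.ν ι V V' hclose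
  obtain ⟨hlo, hhi, -, -⟩ := collar_rows_at_selGapDepth_A θ hP K₀ g₀ os ρ n K t hε hρ0 hρ1 hhalf hcompat
  exact aGapAt_le_core_of_bgClose F N θ.ν M ι V V' (mul_nonneg hε hδ) hAB hBA hlo hhi s hPl

end Summit.QuantumFields.YangMills.Theorems.N21GappedCollarDeficitAtSelectedDepth
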